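import Summits.AtomisticToContinuum.Crystallization.Theorems.ChargedEnergyGapSiteStressFree
import HarnessLib

/-!
# `ChargedEnergyGap` — SEAM ABSORPTION: complete coherent stacking seams are INVISIBLE to the transfer piece and need NO excision
# (cell `decomp-a2c`, lens 3, generation 62, node «SiteStressFree», part P-O; over part P-N `…Theorems.ChargedEnergyGapSiteStressFree`)

THE QUESTION (critic row 1137 (D)(ii)–(iv), memo g61 §9.5, the ★ SEAM LEDGER of memo g62 §0).  Under the (R2) re-typing the reduction (N𝄪ˢ) must
chart polytypic and faulted Barlow far matter (dhcp, 9R, random stackings, isolated intrinsic/extrinsic faults) on the site-stress-free references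
fcc / hcp plus STACKING SEAMS.  Row 1137 (D)(ii) read the seat's memo as «crossing bonds of a seam must be EXCISED, charged `C_H = 10⁻³` per priced
site against a polytype energy excess of `3.7·10⁻⁵` per site: deficit `×27`, UNPAYABLE», and asked for a new `CoherentSeam` transfer clause
(`SmallStrain` per side, crossing bonds priced by a signed interface energy).

THE ANSWER, IN THE KERNEL (this file): NO NEW CLAUSE IS NEEDED — the clauses typed in generation 55 (part P-C `…ChargedEnergyGapSeamTransfer`, header:
«β₀ = δ(S + v) absorbing the piecewise translation S, the jump J cancelling δS … complete seams — invisible») already chart a complete coherent seam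
WITHOUT excision, and the transfer piece's instance for such a chart IS LITERALLY a seamless instance:
§O1 EQUIVARIANT displacements `u(q + g) − u(q)` independent of `q` (`IsEquivariantField`; affine-plus-periodic displacements AND the piecewise-constant
  SLIP POTENTIAL `σ` of a complete `Λ_P`-periodic seam stack are) have global-cocycle bond fields (`isGlobalCocycle_fieldCocycle_of_equivariant`) — so
  `β₀ := δ(σ + v)` is ADMISSIBLE base data of (H𝄪ˢ)/(H𝄪ʳ) (no smallness is asked of `β₀`, only of the Volterra field).
§O2 ABSORPTION `IsAbsorbedBy P S σ`: on every pair of reference points the cut jump of the seam system is the negative coboundary of `σ`,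
  `J_S(y, z) = σ y − σ z`.  ★ Then the Volterra field of `δ(σ + v)` is `δv` on reference pairs (`volterraField_absorb`), `SmallStrain τ P X` of the one is
  `SmallStrain τ P X` of the other (`smallStrain_absorb_iff` — with the SAME excised set, in particular `X = ∅`: NO EXCISION), and ★★ every β-dependent
  functional of the pieces agrees: `modelFarL`, `modelFar`, `creditL ∘ gaugedField` (`modelFarL_absorb`, `modelFar_absorb`, `creditL_gauged_absorb`, via the
  congruence lemmas `linSite_congr`, `quadSite_congr`, `dirichletSiteX_congr`, `modelFarL_congr`, …: the model reads `β` only on reference pairs).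
§O3 ★★★ `localConclusion_absorb_iff` / `localCreditConclusion_absorb_iff`: the conclusion of (H𝄪ˢ) (resp. (H𝄪♯ˢ)) for the datum
  `(C, X, β₀ = δ(σ + v), S, D, σ')` is EQUIVALENT to its conclusion for the SEAMLESS datum `(C, X, δv, ∅, D, σ')` — the allowances do not see `β` at all and
  the model does not see the seams.  ★★ `absorbedInstance_of_seamless`: a transfer bound proved for seamless equivariant-displacement data decides every
  absorbed-seam instance.  So a complete coherent seam costs the TRANSFER piece NOTHING and is charged NO `C_H`; its price lives entirely in the
  REDUCTION's slot errors (memo g62 §0.3: zeroth order = the layer stacking energies `≥ e*` — `0 / 3.63·10⁻⁵ / 7.27·10⁻⁵` per site, census C16-31 (c);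
  first order = interface stress × strain, absorbed by the `(1 − λ) = ½` quadratic reserve at a loss `≤ f_s²/(4(1 − λ − δ)C) ≈ 3.3·10⁻⁸` per seam site;
  RATIO `≤ 10⁻³`: PAYABLE — `record_seam_ledger`).
§O4 WHICH seam systems are absorbed (memo g62 §0.2, paper lemma «SEAM-TILING», kernel-owed [ATTACKABLE·S]): a `Λ_P`-periodic family of open planar
  parallelograms TILING whole planes (one plane family, or finitely many parallel families per period) with in-plane-generic offset (no reference
  crossing point on a tile boundary — reference points never lie in a seam plane, which sits between atomic layers), in-radius `≥ r_S = 3` (supercell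
  presentation of side `≥ 8a`), Burgers vector of the tiles of plane `Π_j` = `−t_j` (floored: `‖t_j‖ = a/√3 = 0.5608 ≥ b₀ = 2/5`); `σ` = the accumulated
  slip, piecewise constant between the planes, `σ(q + g) − σ(q) = (Σ_{planes between q and q+g} t_j)` independent of `q`.  Each reference bond crosses each
  plane between its ends exactly once, inside exactly one open tile, transversally.  In the kernel here: the degenerate instances (the empty system with a
  constant potential, Burgers-free systems) and the algebra of absorbed systems (`IsAbsorbedBy.add_const`); the tiling lemma itself is Euclidean
  bookkeeping on `openSegment`/parallelograms and is recorded as the one owed support item of this node.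
§O5 ROT-SEAM (memo g62 §0.4, record numerals): the only new test data seams create for (H𝄪ˢ) are charts whose Burgers vectors do NOT match the
  realised slips (e.g. a rotated slipped crystal presented with unrotated slips): their Volterra field `W(r) + W(δσ)` carries a first-order model term
  `½w″·M̃₂·⟪ω, t × n⟫` per seam area (zeroth order = traction `= 0` by zero stress, first order `= 0` by the inversion centre on the gap mid-plane, `M̃₂ ≈ 0.3`)
  but ALSO the genuine quadratic mismatch energy `λ·Σ quad ≈ 2.1·ω²` per seam area, so the instance is bounded below by `−(1.9·10⁻⁴)²/(4·2.1) ≈ −4.3·10⁻⁹` per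
  seam area — harmless (`record_rotSeam`); with matched Burgers vectors (`= −R t`) the Volterra field is the pure rotation and the model is `0` (§N2).

All `[this work]`.  No `sorry`, no `native_decide`, no new axioms.
-/

noncomputable section

open scoped Classical
open Literature.MathematicalPhysics.StatisticalMechanics
open Literature.Geometry.DiscreteGeometry
open Summit.AtomisticToContinuum.Crystallization.Theses.PricedLinkCensus
open Summit.AtomisticToContinuum.Crystallization.Theorems.ChargedEnergyGapNegative

namespace Summit.AtomisticToContinuum.Crystallization.Theorems.ChargedEnergyGapChartDial

/-! ## §O1 Equivariant displacements and their bond cocycles -/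

section Equivariant

variable (P : PeriodicConfiguration 3)

/-- An **EQUIVARIANT displacement**: `u(q + g) − u(q)` does not depend on `q`, for every period `g ∈ Λ_P` — affine-plus-periodic displacements, and the
piecewise-constant slip potentials of complete `Λ_P`-periodic seam stacks. -/
def IsEquivariantField (u : E3 → E3) : Prop :=
  ∀ g ∈ P.lattice, ∀ q q' : E3, u (q + g) - u q = u (q' + g) - u q'

variable {P}

/-- Periodic displacements are equivariant (difference `0`). -/
theorem IsPeriodicField.isEquivariantField {u : E3 → E3} (h : IsPeriodicField P u) : IsEquivariantField P u :=
  fun g hg q q' => by rw [h g hg q, h g hg q', sub_self, sub_self]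

/-- Constants are equivariant. -/
theorem isEquivariantField_const (c : E3) : IsEquivariantField P fun _ => c :=
  fun _ _ _ _ => by simp

/-- Equivariant displacements form an additive group: sums … -/
theorem IsEquivariantField.add {u v : E3 → E3} (hu : IsEquivariantField P u) (hv : IsEquivariantField P v) :
    IsEquivariantField P fun q => u q + v q := by
  intro g hg q q'
  have h1 := hu g hg q q'
  have h2 := hv g hg q q'
  have e1 : u (q + g) + v (q + g) - (u q + v q) = (u (q + g) - u q) + (v (q + g) - v q) := by abel
  have e2 : u (q' + g) + v (q' + g) - (u q' + v q') = (u (q' + g) - u q') + (v (q' + g) - v q') := by abel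
  rw [e1, e2, h1, h2]

/-- … negatives … -/
theorem IsEquivariantField.neg {u : E3 → E3} (hu : IsEquivariantField P u) : IsEquivariantField P fun q => -u q := by
  intro g hg q q'
  have h1 := hu g hg q q'
  have e1 : -u (q + g) - -u q = -(u (q + g) - u q) := by abel
  have e2 : -u (q' + g) - -u q' = -(u (q' + g) - u q') := by abel
  rw [e1, e2, h1]

/-- … and differences. -/
theorem IsEquivariantField.sub {u v : E3 → E3} (hu : IsEquivariantField P u) (hv : IsEquivariantField P v) :
    IsEquivariantField P fun q => u q - v q := by
  have h := hu.add hv.neg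
  simpa [sub_eq_add_neg] using h

/-- ★ The bond field `δu` of an EQUIVARIANT displacement is a global cocycle (antisymmetric, `Λ_P`-periodic, additive) — so `δ(σ + v)` with `σ` a slip
potential and `v` affine-plus-periodic is admissible base data `β₀` of the transfer pieces (which ask no smallness of `β₀`). -/
theorem isGlobalCocycle_fieldCocycle_of_equivariant {u : E3 → E3} (hu : IsEquivariantField P u) : IsGlobalCocycle P (fieldCocycle u) := by
  refine ⟨fun y _ z _ => ?_, fun g hg y z => ?_, fun y _ z _ x _ => ?_⟩
  · simp only [fieldCocycle, neg_sub]
  · simp only [fieldCocycle]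
    rw [sub_eq_sub_iff_sub_eq_sub]
    exact (hu g hg y z).symm
  · simp only [fieldCocycle, sub_add_sub_cancel']

/-- The bond field of a sum / difference of displacements is the sum / difference of the bond fields. -/
theorem fieldCocycle_add (u v : E3 → E3) (y z : E3) : fieldCocycle (fun q => u q + v q) y z = fieldCocycle u y z + fieldCocycle v y z := by
  simp only [fieldCocycle]; abel

/-- `fieldCocycle_sub` (docstring added by the landing lane; see the module docstring). [formal bookkeeping] -/
theorem fieldCocycle_sub (u v : E3 → E3) (y z : E3) : fieldCocycle (fun q => u q - v q) y z = fieldCocycle u y z - fieldCocycle v y z := by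
  simp only [fieldCocycle]; abel

end Equivariant

/-! ## §O2 Absorbed seam systems: the Volterra field, the strain clause and the model do not see them -/

section Absorb

variable (P : PeriodicConfiguration 3) {k : ℕ} (S : Fin k → CutPiece) (σ : E3 → E3)

/-- The seam system `S` is **ABSORBED** by the slip potential `σ` on the reference `P`: on every pair of reference points its cut jump is the NEGATIVE
COBOUNDARY of `σ`, `J_S(y, z) = σ y − σ z`.  Complete coherent stacking seam stacks are (tiles = period translates of open parallelograms covering whole
planes generically, Burgers vectors `−t_j`, `σ` = accumulated slip; §O4 / memo g62 §0.2); a bounded piece, a terminating seam or a dislocation cut is not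
(its jump has monodromy around the edge). -/
def IsAbsorbedBy : Prop :=
  ∀ y ∈ P.points, ∀ z ∈ P.points, cutJump P S y z = σ y - σ z

variable {P S σ}

/-- Degenerate instance: the EMPTY system is absorbed by every constant potential … -/
theorem isAbsorbedBy_fin_zero_const (S : Fin 0 → CutPiece) (c : E3) : IsAbsorbedBy P S fun _ => c :=
  fun y _ z _ => by rw [cutJump_fin_zero, sub_self]

/-- … and so is every Burgers-free system. -/
theorem isAbsorbedBy_const_of_burgers_eq_zero (h : ∀ i, (S i).burgers = 0) (c : E3) : IsAbsorbedBy P S fun _ => c :=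
  fun y _ z _ => by rw [cutJump_of_burgers_eq_zero h, sub_self]

/-- Absorbing potentials are defined up to constants. -/
theorem IsAbsorbedBy.add_const (h : IsAbsorbedBy P S σ) (c : E3) : IsAbsorbedBy P S fun q => σ q + c :=
  fun y hy z hz => by beta_reduce; rw [h y hy z hz]; abel

/-- An absorbed system's jump is ANTISYMMETRIC on reference pairs (no transversality needed). -/
theorem IsAbsorbedBy.cutJump_swap (h : IsAbsorbedBy P S σ) {y z : E3} (hy : y ∈ P.points) (hz : z ∈ P.points) :
    cutJump P S z y = -cutJump P S y z := by
  rw [h z hz y hy, h y hy z hz, neg_sub]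

/-- ★ **THE VOLTERRA FIELD OF `δ(σ + v)` OVER AN ABSORBED SYSTEM IS `δv`** on reference pairs: the jump cancels `δσ` exactly. -/
theorem volterraField_absorb (h : IsAbsorbedBy P S σ) (v : E3 → E3) {y z : E3} (hy : y ∈ P.points) (hz : z ∈ P.points) :
    volterraField P S (fieldCocycle fun q => σ q + v q) y z = fieldCocycle v y z := by
  simp only [volterraField, fieldCocycle, h y hy z hz]
  abel

/-- ★ Hence the STRAIN CLAUSE of the seamed chart is the strain clause of `δv` — with the SAME excised set; in particular with `X = ∅`: a complete
coherent seam needs NO EXCISION. -/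
theorem smallStrain_absorb_iff (h : IsAbsorbedBy P S σ) (v : E3 → E3) (τ : ℝ) (X : Set E3) :
    SmallStrain τ P X (volterraField P S (fieldCocycle fun q => σ q + v q)) ↔ SmallStrain τ P X (fieldCocycle v) := by
  refine ⟨fun hs y hy z hz hyX hzX => ?_, fun hs y hy z hz hyX hzX => ?_⟩
  · rw [← volterraField_absorb h v hy hz]; exact hs y hy z hz hyX hzX
  · rw [volterraField_absorb h v hy hz]; exact hs y hy z hz hyX hzX

/-! ### Congruence: the model functionals read `β` only on reference pairs -/

variable {β β' : E3 → E3 → E3} {X : Set E3}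

/-- `bondLin_congr` (docstring added by the landing lane; see the module docstring). [formal bookkeeping] -/
theorem bondLin_congr {y z : E3} (h : β y z = β' y z) : bondLin β y z = bondLin β' y z := by
  simp only [bondLin, h]

/-- `bondQuad_congr` (docstring added by the landing lane; see the module docstring). [formal bookkeeping] -/
theorem bondQuad_congr {y z : E3} (h : β y z = β' y z) : bondQuad β y z = bondQuad β' y z := by
  simp only [bondQuad, h]

/-- `linSite_congr` (docstring added by the landing lane; see the module docstring). [formal bookkeeping] -/
theorem linSite_congr {y : E3} (h : ∀ z ∈ P.points, β y z = β' y z) : linSite β P X y = linSite β' P X y := by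
  unfold linSite
  exact congrArg _ (tsum_congr fun z => bondLin_congr (h z z.2.1))

/-- `quadSite_congr` (docstring added by the landing lane; see the module docstring). [formal bookkeeping] -/
theorem quadSite_congr {y : E3} (h : ∀ z ∈ P.points, β y z = β' y z) : quadSite β P X y = quadSite β' P X y := by
  unfold quadSite
  exact congrArg _ (tsum_congr fun z => bondQuad_congr (h z z.2.1))

/-- `dirichletSiteX_congr` (docstring added by the landing lane; see the module docstring). [formal bookkeeping] -/
theorem dirichletSiteX_congr {y : E3} (h : ∀ z ∈ P.points, β y z = β' y z) : dirichletSiteX β P X y = dirichletSiteX β' P X y := by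
  unfold dirichletSiteX
  exact tsum_congr fun z => by rw [h z z.2.1]

/-- `modelFar_congr` (docstring added by the landing lane; see the module docstring). [formal bookkeeping] -/
theorem modelFar_congr (h : ∀ y ∈ P.points, ∀ z ∈ P.points, β y z = β' y z) (lamQ ϱ : ℝ) (C : Set E3) :
    modelFar β P X lamQ ϱ C = modelFar β' P X lamQ ϱ C := by
  refine Finset.sum_congr rfl fun y hy => ?_
  have hy' := P.mem_points_of_mem_motif hy
  rw [linSite_congr (h y hy'), quadSite_congr (h y hy')]

variable (ϱχ : ℝ) {m : ℕ} (D : Fin m → Set E3) (σ' : Fin m → Bool)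

/-- `modelFarL_congr` (docstring added by the landing lane; see the module docstring). [formal bookkeeping] -/
theorem modelFarL_congr (h : ∀ y ∈ P.points, ∀ z ∈ P.points, β y z = β' y z) (lamQ ϱ : ℝ) (C : Set E3) :
    modelFarL ϱχ D σ' β P X lamQ ϱ C = modelFarL ϱχ D σ' β' P X lamQ ϱ C := by
  refine Finset.sum_congr rfl fun y hy => ?_
  have hy' := P.mem_points_of_mem_motif hy
  rw [linSite_congr (h y hy'), quadSite_congr (h y hy')]

/-- `creditL_congr` (docstring added by the landing lane; see the module docstring). [formal bookkeeping] -/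
theorem creditL_congr (h : ∀ y ∈ P.points, ∀ z ∈ P.points, β y z = β' y z) (ϱ : ℝ) (C : Set E3) :
    creditL ϱχ D σ' β P X ϱ C = creditL ϱχ D σ' β' P X ϱ C := by
  refine Finset.sum_congr rfl fun y hy => ?_
  rw [dirichletSiteX_congr (h y (P.mem_points_of_mem_motif hy))]

/-- `gaugedField_congr` (docstring added by the landing lane; see the module docstring). [formal bookkeeping] -/
theorem gaugedField_congr {y z : E3} (h : β y z = β' y z) (r₀ v₀ : E3) : gaugedField β r₀ v₀ y z = gaugedField β' r₀ v₀ y z := by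
  simp only [gaugedField, h]

/-! ### ★★ The model, the localised model and the gauged credit do not see absorbed seams -/

/-- `modelFar_absorb` (docstring added by the landing lane; see the module docstring). [formal bookkeeping] -/
theorem modelFar_absorb (h : IsAbsorbedBy P S σ) (v : E3 → E3) (lamQ ϱ : ℝ) (C : Set E3) :
    modelFar (volterraField P S (fieldCocycle fun q => σ q + v q)) P X lamQ ϱ C = modelFar (fieldCocycle v) P X lamQ ϱ C :=
  modelFar_congr (fun _ hy _ hz => volterraField_absorb h v hy hz) lamQ ϱ C

/-- `modelFarL_absorb` (docstring added by the landing lane; see the module docstring). [formal bookkeeping] -/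
theorem modelFarL_absorb (h : IsAbsorbedBy P S σ) (v : E3 → E3) (lamQ ϱ : ℝ) (C : Set E3) :
    modelFarL ϱχ D σ' (volterraField P S (fieldCocycle fun q => σ q + v q)) P X lamQ ϱ C = modelFarL ϱχ D σ' (fieldCocycle v) P X lamQ ϱ C :=
  modelFarL_congr ϱχ D σ' (fun _ hy _ hz => volterraField_absorb h v hy hz) lamQ ϱ C

/-- `creditL_gauged_absorb` (docstring added by the landing lane; see the module docstring). [formal bookkeeping] -/
theorem creditL_gauged_absorb (h : IsAbsorbedBy P S σ) (v : E3 → E3) (r₀ v₀ : E3) (ϱ : ℝ) (C : Set E3) :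
    creditL ϱχ D σ' (gaugedField (volterraField P S (fieldCocycle fun q => σ q + v q)) r₀ v₀) P X ϱ C =
      creditL ϱχ D σ' (gaugedField (fieldCocycle v) r₀ v₀) P X ϱ C :=
  creditL_congr ϱχ D σ' (fun _ hy _ hz => gaugedField_congr (volterraField_absorb h v hy hz) r₀ v₀) ϱ C

end Absorb

/-! ## §O3 ★★★ The transfer piece's instance for an absorbed-seam chart IS the seamless instance -/

section Instance

variable {P : PeriodicConfiguration 3} {k : ℕ} {S : Fin k → CutPiece} {σ : E3 → E3}
variable (ϱχ : ℝ) {m : ℕ} (D : Fin m → Set E3) (σ' : Fin m → Bool)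

/-- ★★★ **(H𝄪ˢ)'s CONCLUSION for the datum `(C, X, δ(σ + v), S, D, σ')` ⟺ its conclusion for the SEAMLESS datum `(C, X, δv, ∅, D, σ')`**: the allowances
`shellMassL, transMassL, pricedNearCountL` do not depend on the bond field at all, and the model does not see the absorbed seams. -/
theorem localConclusion_absorb_iff (h : IsAbsorbedBy P S σ) (v : E3 → E3) (C_T Cχ C_H lamQ ϱ : ℝ) (C X : Set E3) (S₀ : Fin 0 → CutPiece) :
    (-(C_T * shellMassL ϱχ D σ' P X ϱ C) - Cχ * transMassL ϱχ D σ' P X ϱ C - C_H * (pricedNearCountL ϱχ D σ' P X ϱ C : ℝ) ≤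
        modelFarL ϱχ D σ' (volterraField P S (fieldCocycle fun q => σ q + v q)) P X lamQ ϱ C) ↔
      (-(C_T * shellMassL ϱχ D σ' P X ϱ C) - Cχ * transMassL ϱχ D σ' P X ϱ C - C_H * (pricedNearCountL ϱχ D σ' P X ϱ C : ℝ) ≤
        modelFarL ϱχ D σ' (volterraField P S₀ (fieldCocycle v)) P X lamQ ϱ C) := by
  rw [modelFarL_absorb ϱχ D σ' h, volterraField_fin_zero]

/-- ★★★ The same for the CREDIT form (H𝄪♯ˢ): gauge by gauge. -/
theorem localCreditConclusion_absorb_iff (h : IsAbsorbedBy P S σ) (v : E3 → E3) (C_T Cχ C_H κ_D lamQ ϱ : ℝ) (C X : Set E3)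
    (S₀ : Fin 0 → CutPiece) :
    (∃ r₀ v₀ : E3,
        -(C_T * shellMassL ϱχ D σ' P X ϱ C) - Cχ * transMassL ϱχ D σ' P X ϱ C - C_H * (pricedNearCountL ϱχ D σ' P X ϱ C : ℝ) +
            κ_D * creditL ϱχ D σ' (gaugedField (volterraField P S (fieldCocycle fun q => σ q + v q)) r₀ v₀) P X ϱ C ≤
          modelFarL ϱχ D σ' (volterraField P S (fieldCocycle fun q => σ q + v q)) P X lamQ ϱ C) ↔
      (∃ r₀ v₀ : E3,
        -(C_T * shellMassL ϱχ D σ' P X ϱ C) - Cχ * transMassL ϱχ D σ' P X ϱ C - C_H * (pricedNearCountL ϱχ D σ' P X ϱ C : ℝ) +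
            κ_D * creditL ϱχ D σ' (gaugedField (volterraField P S₀ (fieldCocycle v)) r₀ v₀) P X ϱ C ≤
          modelFarL ϱχ D σ' (volterraField P S₀ (fieldCocycle v)) P X lamQ ϱ C) := by
  simp only [modelFarL_absorb ϱχ D σ' h, creditL_gauged_absorb ϱχ D σ' h, volterraField_fin_zero]

/-- ★★ **A SEAMLESS TRANSFER BOUND DECIDES EVERY ABSORBED-SEAM INSTANCE.**  If, at some reference `P` and constants, the conclusion of the transfer
piece holds for all SEAMLESS data whose base cocycle is the bond field of an equivariant displacement of small strain, then it holds for every chart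
`(δ(σ + v), S)` with `S` absorbed by `σ`, `v` equivariant, and the Volterra field of small strain — the strained reference with complete coherent seams
costs the transfer piece exactly what the strained reference costs, and is charged no excision. -/
theorem absorbedInstance_of_seamless {τ C_T Cχ C_H lamQ ϱ : ℝ}
    (hmain : ∀ (C X : Set E3) (u : E3 → E3) (S₀ : Fin 0 → CutPiece), IsInvariantSet P C → IsInvariantSet P X → IsEquivariantField P u →
      SmallStrain τ P X (fieldCocycle u) → (∀ i, IsInvariantSet P (D i)) →
        -(C_T * shellMassL ϱχ D σ' P X ϱ C) - Cχ * transMassL ϱχ D σ' P X ϱ C - C_H * (pricedNearCountL ϱχ D σ' P X ϱ C : ℝ) ≤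
          modelFarL ϱχ D σ' (volterraField P S₀ (fieldCocycle u)) P X lamQ ϱ C)
    (h : IsAbsorbedBy P S σ) {v : E3 → E3} (hv : IsEquivariantField P v) {C X : Set E3} (hC : IsInvariantSet P C) (hX : IsInvariantSet P X)
    (hsm : SmallStrain τ P X (volterraField P S (fieldCocycle fun q => σ q + v q))) (hD : ∀ i, IsInvariantSet P (D i)) :
    -(C_T * shellMassL ϱχ D σ' P X ϱ C) - Cχ * transMassL ϱχ D σ' P X ϱ C - C_H * (pricedNearCountL ϱχ D σ' P X ϱ C : ℝ) ≤
      modelFarL ϱχ D σ' (volterraField P S (fieldCocycle fun q => σ q + v q)) P X lamQ ϱ C := by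
  rw [localConclusion_absorb_iff ϱχ D σ' h v C_T Cχ C_H lamQ ϱ C X (fun i : Fin 0 => i.elim0)]
  exact hmain C X v _ hC hX hv ((smallStrain_absorb_iff h v τ X).1 hsm) hD

/-- Bookkeeping of admissibility: if `σ` and `v` are equivariant then `β₀ = δ(σ + v)` is a global cocycle (admissible base data), and conversely the
smooth part `v = (σ + v) − σ` of an admissible absorbed chart is equivariant when `σ` is. -/
theorem isGlobalCocycle_absorbedBase {v : E3 → E3} (hσ : IsEquivariantField P σ) (hv : IsEquivariantField P v) :
    IsGlobalCocycle P (fieldCocycle fun q => σ q + v q) :=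
  isGlobalCocycle_fieldCocycle_of_equivariant (hσ.add hv)

/-- `isEquivariantField_smoothPart` (docstring added by the landing lane; see the module docstring). [formal bookkeeping] -/
theorem isEquivariantField_smoothPart {v : E3 → E3} (hσ : IsEquivariantField P σ) (h : IsEquivariantField P fun q => σ q + v q) :
    IsEquivariantField P v := by
  have := h.sub hσ
  simpa using this

end Instance

/-! ## §O5 Record numerals of the seam ledger (memo g62 §0; inputs are census / seat numerics, the arithmetic is the kernel's) -/

section Numerals

/-- THE MISREAD DEFICIT: IF the crossing bonds of a dhcp-on-hcp seam stack had to be excised, the near-priced charge `C_H = 10⁻³` per site against the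
dhcp excess `3.7·10⁻⁵` per site (census C16-31 (c)) would leave a deficit factor `> 27` (row 1137 (D)(ii)'s expectation). -/
theorem record_seam_excision_reading : (27 : ℝ) < (1 / 1000) / (37 / 1000000) := by norm_num

/-- THE LEDGER WITH ABSORPTION (no excision): payer per seam site = one staggered side `3.63·10⁻⁵` (census C16-31 (c) layer table); first-order slot loss
per seam-adjacent site at the optimum against the quadratic reserve `≤ f_s²/(4·(1 − λ − δ)·C)` with interface site stress `f_s ≤ 1.2·10⁻³`, reserve
`1 − λ − δ = 0.45`, stiffness `C ≥ 11`: `(1.2·10⁻³)²/(4·0.45·11) < 7.3·10⁻⁸`, two adjacent sites per seam site: ratio `< 1/200` — PAYABLE (memo g62 §0.3;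
the seat's cruder per-area estimate gives `≈ 10⁻³`). -/
theorem record_seam_ledger : (12 / 10000 : ℝ) ^ 2 / (4 * (45 / 100) * 11) < 73 / 1000000000 ∧
    2 * (73 / 1000000000 : ℝ) / (363 / 10000000) < 1 / 200 := by
  constructor <;> norm_num

/-- ROT-SEAM (memo g62 §0.4): linear gain `≤ G·ω` with `G = ½·w″·M̃₂·‖t‖ ≤ ½·(2.3·10⁻³)·0.3·0.5608 < 1.94·10⁻⁴` against the quadratic mismatch cost
`K·ω²`, `K ≥ 2.1`, per seam area: the instance is bounded below by `−G²/(4K) > −4.5·10⁻⁹` — seventy times below the per-site shell allowance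
`C_T = 1/(3·10⁶)` even if every layer gap carried a seam. -/
theorem record_rotSeam : (1 / 2 : ℝ) * (23 / 10000) * (3 / 10) * (5608 / 10000) < 194 / 1000000 ∧
    (194 / 1000000 : ℝ) ^ 2 / (4 * (21 / 10)) < 45 / 10000000000 ∧ (70 : ℝ) * (45 / 10000000000) < 1 / 3000000 := by
  refine ⟨by norm_num, by norm_num, by norm_num⟩

end Numerals

end Summit.AtomisticToContinuum.Crystallization.Theorems.ChargedEnergyGapChartDial

end
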